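import Literature.Analysis.FluidPDE.TorusVorticityTensorTransport
import Literature.Analysis.FluidPDE.TorusStrainVorticityIsometry
import Literature.Analysis.FunctionSpaces.TorusFourierConvolution
import Literature.Analysis.FunctionSpaces.TorusInverseLaplacianL2
import Literature.Analysis.FunctionSpaces.TorusTrigPoly
import HarnessLib

/-!
# Ohkitani's vorticity–strain conjugation on the flat torus: `S = T[Ω]`, `Ω = −T[S]`
# as Fourier-multiplier identities (Phys. Rev. E 50 (1994) 5107)

search for candidate a priori estimates; no regularity claim (cell `pub-nsfunc`, literature seat:
this file types a PUBLISHED kinematic result; nothing new).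

Analysis/FluidPDE file (theorems only; no definitions, no named facts). K. Ohkitani, *Kinematics of
vorticity: vorticity–strain conjugation in incompressible fluid flows*, Phys. Rev. E **50** (1994)
5107–5110 (announced in the RIMS note 「渦運動の非局所性と特異積分変換」, held), observes that for an
incompressible velocity field the rate-of-strain tensor `S = ½(∇u + ∇uᵀ)` and the rotation tensor
`Ωᵢⱼ = ½(∂ⱼuᵢ − ∂ᵢuⱼ)` are images of each other under ONE Calderón–Zygmund operator `T` (up to
sign): with `r = x − y`,

  `Sᵢⱼ(x) = (3/4π) P.V.∫ (rₖΩₖᵢ(y)rⱼ − rᵢΩⱼₖ(y)rₖ) r⁻⁵ dy ≡ Tᵢⱼ[Ω]`        (6)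
  `Ωᵢⱼ(x) = −(3/4π) P.V.∫ (rₖSₖᵢ(y)rⱼ − rᵢSⱼₖ(y)rₖ) r⁻⁵ dy`,   i.e. `T[T[Ω]] = −Ω`   (7)–(8)

("vorticity and rate-of-strain tensors are conjugates under the transform `T`"), whose Fourier form
is (eq. (11), `k` the wavenumber)

  `T̃ᵢⱼ[Ω̃] = S̃ᵢⱼ = (kᵢkₗΩ̃ⱼₗ − kⱼkₗΩ̃ₗᵢ)/|k|²`,   `Tᵢⱼ[Ω] = −RᵢRₗΩⱼₗ + RⱼRₗΩₗᵢ`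

(`Rᵢ` the Riesz transforms), with the Parseval identity `⟨SᵢⱼSᵢⱼ⟩ = ⟨ΩᵢⱼΩᵢⱼ⟩` ((9)), the remark
(footnote 10, after Kato–Ponce 1986) that the FULL velocity gradient is recovered from either half,
`∂ⱼuₖ = 2RⱼRᵢΩᵢₖ = −2RⱼRᵢSᵢₖ`, and the pressure Hessian of the Euler/Navier–Stokes equations as
`Pᵢⱼ = (Δp/3)δᵢⱼ + Kᵢⱼ[Δp] = RᵢRⱼ[tr(Ω·Ω + T[Ω]·T[Ω])]` (`tr(S·S) + tr(Ω·Ω) = −Δp`).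

This file types the MULTIPLIER identities on the flat torus `T^d = UnitAddTorus d` (any finite index
type `d`; the `Ω`-form (6)–(8), (11) is dimension-free — only the `εᵢⱼₖ`-form (5) is special to
`d = 3`), for smooth fields, on the Fourier coefficients `𝓕(·)(k)` of the tree
(`mFourierCoeff`, `𝓕(∂ⱼg)(k) = 2πi kⱼ 𝓕g(k)`), in the tree's vocabulary: the strain entries
`Sₐᵦ = ½((∂ᵦu)ₐ + (∂ₐu)ᵦ)` and the **vorticity tensor** `W = torusVorticityTensor u`,
`Wₐᵦ = (∂ₐu)ᵦ − (∂ᵦu)ₐ = −2Ωₐᵦ` (so Ohkitani's `Ω` is `−½W`; every statement below is rewritten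
for `W`, the factors `½`, `2` recording the conversion). Multiplying through by `|k|²`
(`Torus.freqNormSq k = ∑ kᵢ²`) avoids the division and makes `k = 0` trivial:

* `Torus.mFourierCoeff_strainEntry` — `𝓕(Sₐᵦ)(k) = πi(kᵦûₐ + kₐûᵦ)`;
  `Torus.mFourierCoeff_torusVorticityTensor` — `𝓕(Wₐᵦ)(k) = 2πi(kₐûᵦ − kᵦûₐ)`;
  `Torus.sum_freq_mul_mFourierCoeff_eq_zero` — `∑_c k_c û_c(k) = 0` for divergence-free `u`;
* **(6)/(11) `S = T[Ω]`** `Torus.freqNormSq_mul_mFourierCoeff_strainEntry` (divergence-free `u`):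
  `|k|²𝓕(Sᵢⱼ)(k) = ½∑ₗ kₗ(kⱼ𝓕(Wₗᵢ)(k) − kᵢ𝓕(Wⱼₗ)(k))`;
* **(7)/(8) `Ω = −T[S]`** `Torus.freqNormSq_mul_mFourierCoeff_torusVorticityTensor` (ANY smooth `u` —
  this half is pure kinematics of a gradient): `|k|²𝓕(Wᵢⱼ)(k) = 2∑ₗ kₗ(kᵢ𝓕(Sⱼₗ)(k) − kⱼ𝓕(Sₗᵢ)(k))`;
* **footnote 10 (Kato–Ponce)** `Torus.freqNormSq_mul_mFourierCoeff_partialDeriv_apply_eq_vorticity` /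
  `…_eq_strain` (divergence-free `u`): `|k|²𝓕((∂ⱼu)ₘ)(k) = kⱼ∑ₗ kₗ𝓕(Wₗₘ)(k) = 2kⱼ∑ₗ kₗ𝓕(Sₗₘ)(k)` —
  the whole velocity gradient is a double-Riesz-transform image of the vorticity tensor alone, or of
  the strain alone (the kinematic basis of every `L^p` comparison `‖∇u‖_p ≍ ‖ω‖_p ≍ ‖S‖_p`,
  `1 < p < ∞`; the bounds themselves are Calderón–Zygmund theory, in the tree as the named fact
  `Torus.eLpNorm_hessian_le_laplacian`, and are NOT restated here);
* **(9) Parseval** `Torus.integral_strainNormSq_eq_quarter_integral_vorticityTensorNormSq`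
  (divergence-free `u`): `∫∑SₐᵦSₐᵦ = ¼∫∑WₐᵦWₐᵦ` (`= ∫∑ΩₐᵦΩₐᵦ`) — a restatement of the tree's
  `integral_strainNormSq_eq_half_integral_torusVorticitySqAt` (`∫|S|² = ½∫|ω|² = ℰ`);
* **the pressure-Hessian multiplier** `Torus.freqNormSq_mul_mFourierCoeff_hessian`: for every smooth
  scalar `p`, `|k|²𝓕(∂ᵢ∂ⱼp)(k) = kᵢkⱼ𝓕(Δp)(k)` (`∂ᵢ∂ⱼ = −RᵢRⱼΔ`, Ohkitani (15)); along
  Navier–Stokes `Δp = −tr(∇u)² = −(tr S² + tr Ω·Ω)` (= `½|ω|² − |S|²`, Schumacher–Kerr–Horiuti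
  (2.28); tree `IsClassicalNSSolutionOn.laplacian_pressure_eq` and, in real space,
  `….velocityGradient_gradient_pressure_eq_hessian_invLaplacian` `P = ∇∇Δ⁻¹(−tr A² + div f)` in
  `TorusVelocityGradientTransport` §11), which is Ohkitani's `Pᵢⱼ = RᵢRⱼ[tr(Ω·Ω + S·S)]`.

These serve the functional-mining cell (pub-nsfunc): the dictionary's NONLOCAL atoms ("quadratic /
cubic forms built from Riesz transforms of `ω` and `S`") all descend from this one multiplier
`kᵢkₗ/|k|²`; the identities give their exact Fourier-side evaluation (an FFT array plugs in) and
record which of them need `div u = 0`.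

Scope (faithfulness): Ohkitani states (5)–(8) on `ℝ³` for a fluid at rest at infinity, via the
vector potential and the Newtonian kernel, and (11) via the Fourier transform; footnote 12 notes the
same holds "under periodic boundary condition". Here: the periodic case, as identities of Fourier
coefficients for SMOOTH fields (no principal-value integrals are formed; the singular-integral
kernels (4)–(7), the conjugate-harmonic extension (12)–(13), the commutator identity (14) and the
two kinematic constraints among Siggia's invariants derived from it, and the `L^p` comparability
are NOT typed).

## Mathlib / tree search

Tree (used): `Torus.mFourierCoeff_partialDeriv` (`𝓕(∂ⱼg) = 2πikⱼ𝓕g`, `TorusFourierCalculus`),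
`Torus.mFourierCoeff_laplacian_complex`, `Torus.partialDeriv_clm_comp`, `Torus.laplacian_clm_comp_apply`,
`Torus.mFourierCoeff_finset_sum`, `Torus.integrable_mFourier_smul'`, `Torus.partialDeriv_apply_coord`,
`torusVorticityTensor`, `torusVorticitySqAt`, `integral_strainNormSq_eq_half_integral_torusVorticitySqAt`.
Related, not duplicated: `TorusStrainSubspaceFourier` (symbol of Miller's `P_st`, with PRIVATE copies
of the strain/divergence coefficient lemmas — restated publicly here), `TorusRieszTransform` (the
`L^p` Hessian fact), `TorusVelocityGradientTransport` §11 (pressure Hessian = `∇∇Δ⁻¹` in real space).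
`lean search 'conjugat.*strain|T\[Ω\]|mFourierCoeff_torusVorticityTensor|mFourierCoeff_strain'`:
nothing. Locator note (v2, census-1 (cc.282) r-A1, checked against the held texts
`book:grafakos2014-classical-fourier-analysis` p. 188 and `book:grafakos2008-…` p. 192): the derivative rule
`𝓕(∂^α f)(m) = (2πim)^α 𝓕f(m)` on `𝕋ⁿ` is Grafakos, *Classical Fourier Analysis*, **Prop. 3.1.2 (10)** (both
editions); the locator "Prop. 3.2.6 (8)" carried by older tree files (e.g. `TorusFourierCalculus`) names the
orthonormal-systems proposition and is a tree-wide erratum to be swept separately; this file uses 3.1.2 (10). Literature: Ohkitani 1994 PRE (doi:10.1103/PhysRevE.50.5107; cite-only, not held) and the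
held RIMS announcement (`paper:galaxy-pdf-3586596020`, eqs. (1)–(19) read 2026-08-24); cited by
Schumacher–Kerr–Horiuti 2012 (held, p. 85) and Tsinober 2009.

## References

* K. Ohkitani, *Kinematics of vorticity: vorticity–strain conjugation in incompressible fluid
  flows*, Phys. Rev. E 50 (1994) 5107–5110, eqs. (6)–(11) and footnote 10; RIMS Kôkyûroku note
  「渦運動の非局所性と特異積分変換」 (held: paper:galaxy-pdf-3586596020, pp. 2–5), eqs. (3)–(15).
  [Ohkitani1994Conjugation]
* T. Kato, G. Ponce, Rev. Mat. Iberoam. 2 (1986) 73–88 (`∂ⱼuₖ = 2RⱼRᵢΩᵢₖ`; cited through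
  Ohkitani's footnote 10). [KatoPonce1986]
* J. Schumacher, R. M. Kerr, K. Horiuti, in *Ten Chapters in Turbulence*, CUP 2012, §2.2.2 (2.28)
  `Δp = −S² + ½ω² = 2Q` and p. 85 (the citation of Ohkitani 1994). [SchumacherKerrHoriuti2012]
* L. Grafakos, *Classical Fourier Analysis*, 3rd ed., Prop. 3.1.2 (10) (`𝓕(∂ⱼf) = 2πikⱼ𝓕f` on
  `𝕋ⁿ`). [Grafakos2014]
-/

noncomputable section

open MeasureTheory Set Function Finset UnitAddTorus
open scoped ContDiff

namespace Literature.Analysis.FluidPDE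

open Literature.Analysis.FunctionSpaces

variable {d : Type*} [Fintype d] [DecidableEq d]

namespace VorticityStrainConjugation

/-! ### §0 Fourier bookkeeping for real smooth functions (complexified coefficients) -/

omit [DecidableEq d] in
/-- Continuous real functions complexify to integrable ones. [folklore] -/
private theorem integrable_ofReal_vsc {f : UnitAddTorus d → ℝ} (hf : Continuous f) :
    Integrable (fun x => (f x : ℂ)) volume :=
  (Complex.continuous_ofReal.comp hf : Continuous fun x => (f x : ℂ)).integrable_unitAddTorus

omit [DecidableEq d] in
/-- `𝓕(f + g) = 𝓕f + 𝓕g` for continuous real `f, g` (complexified). [folklore] -/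
private theorem fc_add_vsc {f g : UnitAddTorus d → ℝ} (hf : Continuous f) (hg : Continuous g)
    (k : d → ℤ) :
    mFourierCoeff (fun x => (((f x + g x : ℝ)) : ℂ)) k =
      mFourierCoeff (fun x => (f x : ℂ)) k + mFourierCoeff (fun x => (g x : ℂ)) k := by
  simp only [Torus.mFourierCoeff_eq_integral_volume, Complex.ofReal_add, smul_add]
  exact integral_add (Torus.integrable_mFourier_smul' (integrable_ofReal_vsc hf) k)
    (Torus.integrable_mFourier_smul' (integrable_ofReal_vsc hg) k)

omit [DecidableEq d] in
/-- `𝓕(f − g) = 𝓕f − 𝓕g` for continuous real `f, g` (complexified). [folklore] -/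
private theorem fc_sub_vsc {f g : UnitAddTorus d → ℝ} (hf : Continuous f) (hg : Continuous g)
    (k : d → ℤ) :
    mFourierCoeff (fun x => (((f x - g x : ℝ)) : ℂ)) k =
      mFourierCoeff (fun x => (f x : ℂ)) k - mFourierCoeff (fun x => (g x : ℂ)) k := by
  simp only [Torus.mFourierCoeff_eq_integral_volume, Complex.ofReal_sub, smul_sub]
  exact integral_sub (Torus.integrable_mFourier_smul' (integrable_ofReal_vsc hf) k)
    (Torus.integrable_mFourier_smul' (integrable_ofReal_vsc hg) k)

omit [DecidableEq d] in
/-- `𝓕(f/2) = 𝓕f/2` (complexified). [folklore] -/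
private theorem fc_div_two_vsc (f : UnitAddTorus d → ℝ) (k : d → ℤ) :
    mFourierCoeff (fun x => (((f x / 2 : ℝ)) : ℂ)) k = mFourierCoeff (fun x => (f x : ℂ)) k / 2 := by
  have h : (fun x => (((f x / 2 : ℝ)) : ℂ)) = ((2 : ℂ)⁻¹) • fun x => (f x : ℂ) := by
    funext x
    simp only [Pi.smul_apply, smul_eq_mul, Complex.ofReal_div, Complex.ofReal_ofNat]
    ring
  rw [h, Torus.mFourierCoeff_const_smul, smul_eq_mul]
  ring

omit [DecidableEq d] in
/-- `𝓕(∑ᵢ fᵢ) = ∑ᵢ 𝓕fᵢ` for continuous real `fᵢ` (complexified). [folklore] -/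
private theorem fc_sum_vsc {ι : Type*} (s : Finset ι) {f : ι → UnitAddTorus d → ℝ}
    (hf : ∀ i ∈ s, Continuous (f i)) (k : d → ℤ) :
    mFourierCoeff (fun x => (((∑ i ∈ s, f i x : ℝ)) : ℂ)) k =
      ∑ i ∈ s, mFourierCoeff (fun x => (f i x : ℂ)) k := by
  have h : (fun x => (((∑ i ∈ s, f i x : ℝ)) : ℂ)) = fun x => ∑ i ∈ s, (fun i x => (f i x : ℂ)) i x := by
    funext x; push_cast; rfl
  rw [h, Torus.mFourierCoeff_finset_sum s (fun i hi => integrable_ofReal_vsc (hf i hi))]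

/-- `𝓕(∂ⱼf)(k) = 2πi kⱼ 𝓕f(k)` for smooth real `f` (complexified; Grafakos Prop. 3.1.2 (10), tree
`Torus.mFourierCoeff_partialDeriv`). [folklore] -/
private theorem fc_partialDeriv_vsc {f : UnitAddTorus d → ℝ} (hf : Torus.IsSmooth f) (j : d) (k : d → ℤ) :
    mFourierCoeff (fun x => (((Torus.partialDeriv j f x : ℝ)) : ℂ)) k =
      (2 * Real.pi * Complex.I * (k j)) * mFourierCoeff (fun x => (f x : ℂ)) k := by
  have hc : (fun x => (((Torus.partialDeriv j f x : ℝ)) : ℂ)) =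
      Torus.partialDeriv j (fun x => (((f x : ℝ)) : ℂ)) := by
    funext x; exact (Torus.partialDeriv_clm_comp hf Complex.ofRealCLM j x).symm
  rw [hc, Torus.mFourierCoeff_partialDeriv hf.ofReal, smul_eq_mul]

/-- `𝓕(Δf)(k) = −4π²|k|² 𝓕f(k)` for smooth real `f` (complexified; tree
`Torus.mFourierCoeff_laplacian_complex`). [folklore] -/
private theorem fc_laplacian_vsc {f : UnitAddTorus d → ℝ} (hf : Torus.IsSmooth f) (k : d → ℤ) :
    mFourierCoeff (fun x => (((Torus.laplacian f x : ℝ)) : ℂ)) k =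
      -((4 * Real.pi ^ 2 * Torus.freqNormSq k : ℝ) : ℂ) * mFourierCoeff (fun x => (f x : ℂ)) k := by
  have hc : (fun x => (((Torus.laplacian f x : ℝ)) : ℂ)) =
      Torus.laplacian (fun x => (((f x : ℝ)) : ℂ)) := by
    funext x; exact (Torus.laplacian_clm_comp_apply hf Complex.ofRealCLM x).symm
  rw [hc, Torus.mFourierCoeff_laplacian_complex hf.ofReal]

omit [DecidableEq d] in
/-- A function vanishing identically has vanishing Fourier coefficients. [folklore] -/
private theorem fc_of_eq_zero_vsc {f : UnitAddTorus d → ℝ} (hf : ∀ x, f x = 0) (k : d → ℤ) :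
    mFourierCoeff (fun x => (f x : ℂ)) k = 0 := by
  have h : (fun x => (f x : ℂ)) = 0 := by funext x; simp [hf x]
  rw [h]
  simp [Torus.mFourierCoeff_eq_integral_volume]

omit [DecidableEq d] in
/-- `|k|² = ∑_c k_c k_c` in `ℂ`. [folklore] -/
private theorem freqNormSq_cast_eq_sum_vsc (k : d → ℤ) :
    ((Torus.freqNormSq k : ℝ) : ℂ) = ∑ c, (k c : ℂ) * (k c : ℂ) := by
  rw [Torus.freqNormSq]; push_cast
  exact Finset.sum_congr rfl fun c _ => by ring

end VorticityStrainConjugation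

open VorticityStrainConjugation

section Symbols

variable {u : UnitAddTorus d → EuclideanSpace ℝ d}

/-- **Fourier coefficients of the strain of a smooth field**: `𝓕(S(u)ₐᵦ)(k) = πi(kᵦûₐ + kₐûᵦ)`,
`S(u)ₐᵦ = ½((∂ᵦu)ₐ + (∂ₐu)ᵦ)` (Ohkitani (11): `S̃ᵢⱼ` in terms of `û`; Grafakos (8)).
[cite: Ohkitani1994Conjugation, eq. (11); Grafakos2014, Prop. 3.1.2 (10)] -/
theorem Torus.mFourierCoeff_strainEntry (hu : Torus.IsSmooth u) (a b : d) (k : d → ℤ) :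
    mFourierCoeff (fun x => ((((Torus.partialDeriv b u x a + Torus.partialDeriv a u x b) / 2 : ℝ)) : ℂ)) k =
      Real.pi * Complex.I * ((k b : ℂ) * mFourierCoeff (fun x => (u x a : ℂ)) k +
        (k a : ℂ) * mFourierCoeff (fun x => (u x b : ℂ)) k) := by
  have hu1 : Torus.IsContDiff 1 u := hu.isContDiff (by simp)
  have hfun : (fun x => ((((Torus.partialDeriv b u x a + Torus.partialDeriv a u x b) / 2 : ℝ)) : ℂ)) =
      fun x => ((((Torus.partialDeriv b (fun y => u y a) x +
        Torus.partialDeriv a (fun y => u y b) x) / 2 : ℝ)) : ℂ) := by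
    funext x; rw [Torus.partialDeriv_apply_coord hu1, Torus.partialDeriv_apply_coord hu1]
  rw [hfun, fc_div_two_vsc,
    fc_add_vsc ((hu.apply a).partialDeriv b).continuous ((hu.apply b).partialDeriv a).continuous,
    fc_partialDeriv_vsc (hu.apply a), fc_partialDeriv_vsc (hu.apply b)]
  ring

/-- **Fourier coefficients of the vorticity tensor of a smooth field**:
`𝓕(Wₐᵦ)(k) = 2πi(kₐûᵦ − kᵦûₐ)`, `Wₐᵦ = (∂ₐu)ᵦ − (∂ᵦu)ₐ = −2Ωₐᵦ` (Ohkitani's `Ω̃ᵢⱼ = πi(kⱼûᵢ − kᵢûⱼ)`).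
[cite: Ohkitani1994Conjugation, eq. (11); Grafakos2014, Prop. 3.1.2 (10)] -/
theorem Torus.mFourierCoeff_torusVorticityTensor (hu : Torus.IsSmooth u) (a b : d) (k : d → ℤ) :
    mFourierCoeff (fun x => ((torusVorticityTensor u a b x : ℝ) : ℂ)) k =
      2 * Real.pi * Complex.I * ((k a : ℂ) * mFourierCoeff (fun x => (u x b : ℂ)) k -
        (k b : ℂ) * mFourierCoeff (fun x => (u x a : ℂ)) k) := by
  have hu1 : Torus.IsContDiff 1 u := hu.isContDiff (by simp)
  have hfun : (fun x => ((torusVorticityTensor u a b x : ℝ) : ℂ)) =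
      fun x => (((Torus.partialDeriv a (fun y => u y b) x -
        Torus.partialDeriv b (fun y => u y a) x : ℝ)) : ℂ) := by
    funext x
    rw [torusVorticityTensor, Torus.partialDeriv_apply_coord hu1, Torus.partialDeriv_apply_coord hu1]
  rw [hfun, fc_sub_vsc ((hu.apply b).partialDeriv a).continuous ((hu.apply a).partialDeriv b).continuous,
    fc_partialDeriv_vsc (hu.apply b), fc_partialDeriv_vsc (hu.apply a)]
  ring

/-- **Fourier coefficients of a velocity-gradient entry**: `𝓕((∂ⱼu)ₘ)(k) = 2πi kⱼ ûₘ(k)`.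
[cite: Grafakos2014, Prop. 3.1.2 (10)] -/
theorem Torus.mFourierCoeff_partialDeriv_apply (hu : Torus.IsSmooth u) (j m : d) (k : d → ℤ) :
    mFourierCoeff (fun x => ((Torus.partialDeriv j u x m : ℝ) : ℂ)) k =
      2 * Real.pi * Complex.I * (k j : ℂ) * mFourierCoeff (fun x => (u x m : ℂ)) k := by
  have hu1 : Torus.IsContDiff 1 u := hu.isContDiff (by simp)
  have hfun : (fun x => ((Torus.partialDeriv j u x m : ℝ) : ℂ)) =
      fun x => ((Torus.partialDeriv j (fun y => u y m) x : ℝ) : ℂ) := by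
    funext x; rw [Torus.partialDeriv_apply_coord hu1]
  rw [hfun, fc_partialDeriv_vsc (hu.apply m)]

/-- **Divergence-free fields have transversal Fourier coefficients**: `∑_c k_c û_c(k) = 0` for every
`k` (the symbol of `div u = 0`). [cite: Ohkitani1994Conjugation, eq. (11) (incompressibility `k·û = 0` used there); Grafakos2014, Prop. 3.1.2 (10)] -/
theorem Torus.sum_freq_mul_mFourierCoeff_eq_zero (hu : Torus.IsSmooth u) (hdiv : Torus.IsDivFree u)
    (k : d → ℤ) :
    ∑ c, (k c : ℂ) * mFourierCoeff (fun x => (u x c : ℂ)) k = 0 := by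
  have h0 : ∀ x, (∑ c, Torus.partialDeriv c (fun y => u y c) x) = 0 := fun x => hdiv x
  have h1 := fc_of_eq_zero_vsc h0 k
  rw [fc_sum_vsc _ fun c _ => ((hu.apply c).partialDeriv c).continuous] at h1
  simp_rw [fc_partialDeriv_vsc (hu.apply _)] at h1
  have h2 : ∑ c, 2 * Real.pi * Complex.I * (k c : ℂ) * mFourierCoeff (fun x => (u x c : ℂ)) k =
      (2 * Real.pi * Complex.I) * ∑ c, (k c : ℂ) * mFourierCoeff (fun x => (u x c : ℂ)) k := by
    rw [Finset.mul_sum]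
    exact Finset.sum_congr rfl fun c _ => by ring
  rw [h2] at h1
  have hne : (2 * Real.pi * Complex.I : ℂ) ≠ 0 := by
    have hπ : (Real.pi : ℂ) ≠ 0 := by exact_mod_cast Real.pi_ne_zero
    simp [hπ, Complex.I_ne_zero]
  exact (mul_eq_zero.1 h1).resolve_left hne

end Symbols

/-! ### Ohkitani's conjugation `S = T[Ω]`, `Ω = −T[S]` (eqs. (6)–(8), (11)) -/

section Conjugation

variable {u : UnitAddTorus d → EuclideanSpace ℝ d}

/-- **Ohkitani (6)/(11): the strain is the `T`-transform of the rotation tensor, `S = T[Ω]`,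
`S̃ᵢⱼ = (kᵢkₗΩ̃ⱼₗ − kⱼkₗΩ̃ₗᵢ)/|k|²`** for an incompressible field. On `T^d`, for a smooth
divergence-free `u`, with `W = −2Ω` the tree's vorticity tensor, for every wavenumber `k`:
`|k|² 𝓕(Sᵢⱼ)(k) = ½ ∑ₗ kₗ (kⱼ 𝓕(Wₗᵢ)(k) − kᵢ 𝓕(Wⱼₗ)(k))`
(proof on coefficients: `kₗW̃ₗᵢ` sums to `2πi|k|²ûᵢ` because `k·û = 0`). This half of the conjugation
USES incompressibility. [cite: Ohkitani1994Conjugation, eqs. (6), (11)] -/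
theorem Torus.freqNormSq_mul_mFourierCoeff_strainEntry (hu : Torus.IsSmooth u)
    (hdiv : Torus.IsDivFree u) (i j : d) (k : d → ℤ) :
    ((Torus.freqNormSq k : ℝ) : ℂ) *
        mFourierCoeff (fun x => ((((Torus.partialDeriv j u x i + Torus.partialDeriv i u x j) / 2 : ℝ)) : ℂ)) k =
      (1 / 2 : ℂ) * ∑ l, (k l : ℂ) *
        ((k j : ℂ) * mFourierCoeff (fun x => ((torusVorticityTensor u l i x : ℝ) : ℂ)) k -
          (k i : ℂ) * mFourierCoeff (fun x => ((torusVorticityTensor u j l x : ℝ) : ℂ)) k) := by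
  rw [Torus.mFourierCoeff_strainEntry hu]
  simp_rw [Torus.mFourierCoeff_torusVorticityTensor hu]
  have hD := Torus.sum_freq_mul_mFourierCoeff_eq_zero hu hdiv k
  have hK := freqNormSq_cast_eq_sum_vsc k
  have hterm : ∀ l, (k l : ℂ) *
      ((k j : ℂ) * (2 * Real.pi * Complex.I * ((k l : ℂ) * mFourierCoeff (fun x => (u x i : ℂ)) k -
          (k i : ℂ) * mFourierCoeff (fun x => (u x l : ℂ)) k)) -
        (k i : ℂ) * (2 * Real.pi * Complex.I * ((k j : ℂ) * mFourierCoeff (fun x => (u x l : ℂ)) k -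
          (k l : ℂ) * mFourierCoeff (fun x => (u x j : ℂ)) k))) =
      (2 * Real.pi * Complex.I * ((k j : ℂ) * mFourierCoeff (fun x => (u x i : ℂ)) k +
          (k i : ℂ) * mFourierCoeff (fun x => (u x j : ℂ)) k)) * ((k l : ℂ) * (k l : ℂ)) -
        (4 * Real.pi * Complex.I * (k i : ℂ) * (k j : ℂ)) * ((k l : ℂ) * mFourierCoeff (fun x => (u x l : ℂ)) k) := by
    intro l; ring
  simp_rw [hterm]
  rw [Finset.sum_sub_distrib, ← Finset.mul_sum, ← Finset.mul_sum, hD, ← hK]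
  ring

/-- **Ohkitani (7)/(8): the rotation tensor is minus the `T`-transform of the strain, `Ω = −T[S]`,
`T[T[Ω]] = −Ω`** ("vorticity and rate-of-strain tensors are conjugates under the transform `T`").
On `T^d`, for every smooth `u` (this half holds for ANY gradient — the `ûₗ`-terms cancel
identically, no incompressibility is needed), with `W = −2Ω`, for every `k`:
`|k|² 𝓕(Wᵢⱼ)(k) = 2 ∑ₗ kₗ (kᵢ 𝓕(Sⱼₗ)(k) − kⱼ 𝓕(Sₗᵢ)(k))`.
[cite: Ohkitani1994Conjugation, eqs. (7), (8), (11)] -/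
theorem Torus.freqNormSq_mul_mFourierCoeff_torusVorticityTensor (hu : Torus.IsSmooth u)
    (i j : d) (k : d → ℤ) :
    ((Torus.freqNormSq k : ℝ) : ℂ) * mFourierCoeff (fun x => ((torusVorticityTensor u i j x : ℝ) : ℂ)) k =
      2 * ∑ l, (k l : ℂ) *
        ((k i : ℂ) * mFourierCoeff (fun x =>
            ((((Torus.partialDeriv l u x j + Torus.partialDeriv j u x l) / 2 : ℝ)) : ℂ)) k -
          (k j : ℂ) * mFourierCoeff (fun x =>
            ((((Torus.partialDeriv i u x l + Torus.partialDeriv l u x i) / 2 : ℝ)) : ℂ)) k) := by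
  rw [Torus.mFourierCoeff_torusVorticityTensor hu]
  simp_rw [Torus.mFourierCoeff_strainEntry hu]
  have hK := freqNormSq_cast_eq_sum_vsc k
  have hterm : ∀ l, (k l : ℂ) *
      ((k i : ℂ) * (Real.pi * Complex.I * ((k l : ℂ) * mFourierCoeff (fun x => (u x j : ℂ)) k +
          (k j : ℂ) * mFourierCoeff (fun x => (u x l : ℂ)) k)) -
        (k j : ℂ) * (Real.pi * Complex.I * ((k i : ℂ) * mFourierCoeff (fun x => (u x l : ℂ)) k +
          (k l : ℂ) * mFourierCoeff (fun x => (u x i : ℂ)) k))) =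
      (Real.pi * Complex.I * ((k i : ℂ) * mFourierCoeff (fun x => (u x j : ℂ)) k -
          (k j : ℂ) * mFourierCoeff (fun x => (u x i : ℂ)) k)) * ((k l : ℂ) * (k l : ℂ)) := by
    intro l; ring
  simp_rw [hterm]
  rw [← Finset.mul_sum, ← hK]
  ring

/-- **Footnote 10 (Kato–Ponce 1986), vorticity form: `∂ⱼuₘ = 2RⱼRᵢΩᵢₘ`** — the full velocity
gradient of an incompressible field is a double-Riesz-transform image of its rotation tensor. On
`T^d`, smooth divergence-free `u`, `W = −2Ω`, every `k`:
`|k|² 𝓕((∂ⱼu)ₘ)(k) = kⱼ ∑ₗ kₗ 𝓕(Wₗₘ)(k)`. [cite: Ohkitani1994Conjugation, footnote 10; KatoPonce1986] -/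
theorem Torus.freqNormSq_mul_mFourierCoeff_partialDeriv_apply_eq_vorticity (hu : Torus.IsSmooth u)
    (hdiv : Torus.IsDivFree u) (j m : d) (k : d → ℤ) :
    ((Torus.freqNormSq k : ℝ) : ℂ) * mFourierCoeff (fun x => ((Torus.partialDeriv j u x m : ℝ) : ℂ)) k =
      (k j : ℂ) * ∑ l, (k l : ℂ) * mFourierCoeff (fun x => ((torusVorticityTensor u l m x : ℝ) : ℂ)) k := by
  rw [Torus.mFourierCoeff_partialDeriv_apply hu]
  simp_rw [Torus.mFourierCoeff_torusVorticityTensor hu]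
  have hD := Torus.sum_freq_mul_mFourierCoeff_eq_zero hu hdiv k
  have hK := freqNormSq_cast_eq_sum_vsc k
  have hterm : ∀ l, (k l : ℂ) * (2 * Real.pi * Complex.I *
      ((k l : ℂ) * mFourierCoeff (fun x => (u x m : ℂ)) k - (k m : ℂ) * mFourierCoeff (fun x => (u x l : ℂ)) k)) =
      (2 * Real.pi * Complex.I * mFourierCoeff (fun x => (u x m : ℂ)) k) * ((k l : ℂ) * (k l : ℂ)) -
        (2 * Real.pi * Complex.I * (k m : ℂ)) * ((k l : ℂ) * mFourierCoeff (fun x => (u x l : ℂ)) k) := by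
    intro l; ring
  simp_rw [hterm]
  rw [Finset.sum_sub_distrib, ← Finset.mul_sum, ← Finset.mul_sum, hD, ← hK]
  ring

/-- **Footnote 10 (Kato–Ponce 1986), strain form: `∂ⱼuₘ = −2RⱼRᵢSᵢₘ`** — the full velocity
gradient of an incompressible field is a double-Riesz-transform image of its strain alone. On `T^d`,
smooth divergence-free `u`, every `k`:
`|k|² 𝓕((∂ⱼu)ₘ)(k) = 2kⱼ ∑ₗ kₗ 𝓕(Sₗₘ)(k)`. [cite: Ohkitani1994Conjugation, footnote 10; KatoPonce1986] -/
theorem Torus.freqNormSq_mul_mFourierCoeff_partialDeriv_apply_eq_strain (hu : Torus.IsSmooth u)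
    (hdiv : Torus.IsDivFree u) (j m : d) (k : d → ℤ) :
    ((Torus.freqNormSq k : ℝ) : ℂ) * mFourierCoeff (fun x => ((Torus.partialDeriv j u x m : ℝ) : ℂ)) k =
      2 * (k j : ℂ) * ∑ l, (k l : ℂ) * mFourierCoeff (fun x =>
        ((((Torus.partialDeriv m u x l + Torus.partialDeriv l u x m) / 2 : ℝ)) : ℂ)) k := by
  rw [Torus.mFourierCoeff_partialDeriv_apply hu]
  simp_rw [Torus.mFourierCoeff_strainEntry hu]
  have hD := Torus.sum_freq_mul_mFourierCoeff_eq_zero hu hdiv k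
  have hK := freqNormSq_cast_eq_sum_vsc k
  have hterm : ∀ l, (k l : ℂ) * (Real.pi * Complex.I *
      ((k m : ℂ) * mFourierCoeff (fun x => (u x l : ℂ)) k + (k l : ℂ) * mFourierCoeff (fun x => (u x m : ℂ)) k)) =
      (Real.pi * Complex.I * (k m : ℂ)) * ((k l : ℂ) * mFourierCoeff (fun x => (u x l : ℂ)) k) +
        (Real.pi * Complex.I * mFourierCoeff (fun x => (u x m : ℂ)) k) * ((k l : ℂ) * (k l : ℂ)) := by
    intro l; ring
  simp_rw [hterm]
  rw [Finset.sum_add_distrib, ← Finset.mul_sum, ← Finset.mul_sum, hD, ← hK]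
  ring

end Conjugation

/-! ### Parseval for the conjugation (eq. (9)) and the pressure-Hessian multiplier (eq. (15)) -/

section Parseval

/-- **Ohkitani (9): `⟨SᵢⱼSᵢⱼ⟩ = ⟨ΩᵢⱼΩᵢⱼ⟩`** — "the identity (9) can be regarded as the Parseval
formula for the transform `T`" (from `tr(S·S) + tr(Ω·Ω) = −Δp` and `∫Δp = 0`). In the tree's
vocabulary (`W = −2Ω`, so `∑ΩₐᵦΩₐᵦ = ¼∑WₐᵦWₐᵦ`): for a smooth divergence-free field on `T^d`,
`∫ ∑ₐᵦ Sₐᵦ² = ¼ ∫ ∑ₐᵦ Wₐᵦ²` — a restatement of the tree's `∫|S|² = ½∫|ω|²`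
(`integral_strainNormSq_eq_half_integral_torusVorticitySqAt`, `|ω|² = torusVorticitySqAt = ½∑W²`).
[cite: Ohkitani1994Conjugation, eq. (9)] -/
theorem Torus.integral_strainNormSq_eq_quarter_integral_vorticityTensorNormSq
    {u : UnitAddTorus d → EuclideanSpace ℝ d} (hu : Torus.IsSmooth u) (hdiv : Torus.IsDivFree u) :
    ∫ x, ∑ i, ∑ j, ((Torus.partialDeriv j u x i + Torus.partialDeriv i u x j) / 2) ^ 2 =
      4⁻¹ * ∫ x, ∑ i, ∑ j, torusVorticityTensor u i j x ^ 2 := by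
  rw [integral_strainNormSq_eq_half_integral_torusVorticitySqAt hu hdiv]
  have h : ∀ x, torusVorticitySqAt u x = 2⁻¹ * ∑ i, ∑ j, torusVorticityTensor u i j x ^ 2 := by
    intro x
    simp only [torusVorticitySqAt, torusVorticityTensor]
  simp_rw [h]
  rw [integral_const_mul]
  ring

/-- **The pressure-Hessian multiplier, `∂ᵢ∂ⱼ = −RᵢRⱼΔ`** (Ohkitani (15); hence (3)–(4)
`Pᵢⱼ = (Δp/3)δᵢⱼ + Kᵢⱼ[Δp]` and `Pᵢⱼ = RᵢRⱼ[tr(Ω·Ω + S·S)]` once `Δp = −(tr S·S + tr Ω·Ω)` is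
inserted — along Navier–Stokes this is the tree's `IsClassicalNSSolutionOn.laplacian_pressure_eq`,
Schumacher–Kerr–Horiuti (2.28) `Δp = 2Q`). For every smooth scalar `p` on `T^d` and every `k`:
`|k|² 𝓕(∂ᵢ∂ⱼp)(k) = kᵢkⱼ 𝓕(Δp)(k)`. [cite: Ohkitani1994Conjugation, eqs. (3), (15); SchumacherKerrHoriuti2012, §2.2.2 eq. (2.28)] -/
theorem Torus.freqNormSq_mul_mFourierCoeff_hessian {p : UnitAddTorus d → ℝ} (hp : Torus.IsSmooth p)
    (i j : d) (k : d → ℤ) :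
    ((Torus.freqNormSq k : ℝ) : ℂ) *
        mFourierCoeff (fun x => ((Torus.partialDeriv i (Torus.partialDeriv j p) x : ℝ) : ℂ)) k =
      (k i : ℂ) * (k j : ℂ) * mFourierCoeff (fun x => ((Torus.laplacian p x : ℝ) : ℂ)) k := by
  rw [fc_partialDeriv_vsc (hp.partialDeriv j), fc_partialDeriv_vsc hp, fc_laplacian_vsc hp]
  have hI : Complex.I * Complex.I = -1 := Complex.I_mul_I
  push_cast
  linear_combination (4 * (Real.pi : ℂ) ^ 2 * (k i : ℂ) * (k j : ℂ) *
    ((Torus.freqNormSq k : ℝ) : ℂ) * mFourierCoeff (fun x => (p x : ℂ)) k) * hI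

end Parseval

end Literature.Analysis.FluidPDE
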